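import Literature.Geometry.DiscreteGeometry.KissingPatterns
import Mathlib.Analysis.InnerProductSpace.PiL2
import Mathlib.Analysis.Normed.Module.FiniteDimension
import Summits.AtomisticToContinuum.Crystallization.Theses.PalmUnimodularRigidity
import Summits.AtomisticToContinuum.Crystallization.Theorems.PhononSlackCertificatesNearFarGlueRCoverFcc

/-!
# Covering radius `45°` of the FCC and HCP kissing patterns (stub 5, r5)

Stub `stub_patternCovering` (stub 5) of line `elastic-coarse-to-fine` (reshape r5) of crux `MinimiserShells`
(stmt-AtomisticToContinuum-9225, route `PalmUnimodularRigidity`).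

Statement.  For every linear isometry `A` of `ℝ³` and every vector `u` there is a point `p` of the FCC
kissing pattern (the twelve unit vectors `(±1, ±1, 0)/√2` and permutations) and a point of the HCP kissing
pattern (the anticuboctahedron) with `‖u‖² ≤ 2⟪u, A p⟫²` and `0 ≤ ⟪u, A p⟫`, i.e. the angle between `u`
and `A p` is at most `45°`.  The bound is sharp (centres of the square faces).

Proof.  `A` is a linear isometry of a `3`-dimensional space, hence a linear isometric equivalence
(`LinearIsometry.toLinearIsometryEquiv`); writing `u = A v` gives `‖u‖ = ‖v‖` and `⟪u, A p⟫ = ⟪v, p⟫`, so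
`A = id` suffices.  Both patterns are `{w/√N : w ∈ S}` for a finite `S ⊆ ℤ³` (`scaledPattern`), and for
such a point `2⟪v, w/√N⟫² = 2⟪v, w⟫²/N`, so it suffices to exhibit `w ∈ S` with `0 ≤ ⟪v, w⟫` and
`N·‖v‖² ≤ 2⟪v, w⟫²` (`cover_of_witness`).  Write `v = (x, y, z)`.

* FCC (`N = 2`): drop the coordinate of least absolute value, say `z`, and take `w = (sign x, sign y, 0)`:
  `⟪v, w⟫ = |x| + |y| ≥ 0` and `(|x| + |y|)² = x² + y² + 2|x||y| ≥ x² + y² + z²` (`abs_key`).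
* HCP (`N = 18`): if `x + y + z ≥ 0` then one of the nine linear forms `x+y, x+z, y+z, ±(x−y), ±(x−z),
  ±(y−z)` is `≥ 0` with square `≥ x² + y² + z²` (`hex_key`; after sorting `x ≥ y ≥ z` it is `x + y` or
  `x − z`, `hex_sorted`); these are `⟪v, w⟫` for `w ∈ {(1,1,0),(1,0,1),(0,1,1), ±(1,−1,0), ±(1,0,−1),
  ±(0,1,−1)}` and `3w ∈ hcpInt` (upper triangle and hexagon).  If `x + y + z ≤ 0` apply this to the mirror
  image `v' = v − (2/3)(x+y+z)(1,1,1)` of `v` in the hexagonal plane (same norm, coordinate sum `≥ 0`) and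
  use the mirror image `3w − 2(w₀+w₁+w₂)(1,1,1) ∈ hcpInt` of `3w` (hexagon and lower triangle
  `(−1,−1,−4), (−1,−4,−1), (−4,−1,−1)`), for which `⟪v, 3w − 2σ(1,1,1)⟫ = 3⟪v', w⟫`.

Only Mathlib, `Literature.Geometry.DiscreteGeometry.KissingPatterns` and the landed sign lemma
`PhononSlackCertificatesNearFarGlueR.coverFcc_sign` (file `PhononSlackCertificatesNearFarGlueRCoverFcc`)
are used.
-/

noncomputable section

namespace Summit.AtomisticToContinuum.Crystallization.Theorems.PalmUnimodularRigidityMinimiserShells.PatternCovering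

open Literature.Geometry.DiscreteGeometry (fccKissingPattern hcpKissingPattern fccInt hcpInt scaledPattern
  intVec intVec_apply)
open Summit.AtomisticToContinuum.Crystallization.Theorems.PhononSlackCertificatesNearFarGlueR (coverFcc_sign)

/-! ### Real-arithmetic keys -/

/-- If `|c| ≤ |a|` and `|c| ≤ |b|` then `a² + b² + c² ≤ (|a| + |b|)²` (since `c² ≤ |a||b| ≤ 2|a||b|`). -/
theorem abs_key (a b c : ℝ) (ha : |c| ≤ |a|) (hb : |c| ≤ |b|) :
    a ^ 2 + b ^ 2 + c ^ 2 ≤ (|a| + |b|) ^ 2 := by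
  have h : |c| * |c| ≤ |a| * |b| := mul_le_mul ha hb (abs_nonneg c) (abs_nonneg a)
  have h' : c ^ 2 ≤ |a| * |b| := by rw [sq, ← abs_mul_abs_self c]; exact h
  have e : (|a| + |b|) ^ 2 = a ^ 2 + b ^ 2 + 2 * (|a| * |b|) := by
    rw [add_sq, sq_abs, sq_abs]; ring
  rw [e]
  linarith [mul_nonneg (abs_nonneg a) (abs_nonneg b)]

/-- Packaging a leaf of `fcc_key`. -/
theorem fcc_leaf {x y z : ℝ} (a b c : ℤ) (hmem : ![a, b, c] ∈ fccInt) {m : ℝ}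
    (hm : (a : ℝ) * x + b * y + c * z = m) (h0 : 0 ≤ m) (h1 : x ^ 2 + y ^ 2 + z ^ 2 ≤ m ^ 2) :
    ∃ a b c : ℤ, ![a, b, c] ∈ fccInt ∧ 0 ≤ (a : ℝ) * x + b * y + c * z ∧
      x ^ 2 + y ^ 2 + z ^ 2 ≤ ((a : ℝ) * x + b * y + c * z) ^ 2 :=
  ⟨a, b, c, hmem, by rw [hm]; exact h0, by rw [hm]; exact h1⟩

/-- **FCC key.** For every `(x, y, z)` some `w ∈ fccInt` (a vector `(±1, ±1, 0)` up to permutation) has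
`0 ≤ ⟪(x,y,z), w⟫` and `x² + y² + z² ≤ ⟪(x,y,z), w⟫²`: drop the coordinate of least absolute value and
take the signs of the other two (`coverFcc_sign`). -/
theorem fcc_key (x y z : ℝ) :
    ∃ a b c : ℤ, ![a, b, c] ∈ fccInt ∧ 0 ≤ (a : ℝ) * x + b * y + c * z ∧
      x ^ 2 + y ^ 2 + z ^ 2 ≤ ((a : ℝ) * x + b * y + c * z) ^ 2 := by
  obtain ⟨s, hs, hsx⟩ := coverFcc_sign x
  obtain ⟨t, ht, hty⟩ := coverFcc_sign y
  obtain ⟨r, hr, hrz⟩ := coverFcc_sign z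
  rcases le_total |z| |x| with hzx | hxz
  · rcases le_total |z| |y| with hzy | hyz
    · -- `|z|` is minimal: `w = (s, t, 0)`
      exact fcc_leaf s t 0 (by rcases hs with rfl | rfl <;> rcases ht with rfl | rfl <;> decide)
        (m := |x| + |y|) (by rw [← hsx, ← hty]; push_cast; ring) (by positivity) (abs_key x y z hzx hzy)
    · -- `|y| ≤ |z| ≤ |x|`: `w = (s, 0, r)`
      exact fcc_leaf s 0 r (by rcases hs with rfl | rfl <;> rcases hr with rfl | rfl <;> decide)
        (m := |x| + |z|) (by rw [← hsx, ← hrz]; push_cast; ring) (by positivity)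
        (by linarith [abs_key x z y (hyz.trans hzx) hyz])
  · rcases le_total |x| |y| with hxy | hyx
    · -- `|x|` is minimal: `w = (0, t, r)`
      exact fcc_leaf 0 t r (by rcases ht with rfl | rfl <;> rcases hr with rfl | rfl <;> decide)
        (m := |y| + |z|) (by rw [← hty, ← hrz]; push_cast; ring) (by positivity)
        (by linarith [abs_key y z x hxy hxz])
    · -- `|y| ≤ |x| ≤ |z|`: `w = (s, 0, r)`
      exact fcc_leaf s 0 r (by rcases hs with rfl | rfl <;> rcases hr with rfl | rfl <;> decide)
        (m := |x| + |z|) (by rw [← hsx, ← hrz]; push_cast; ring) (by positivity)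
        (by linarith [abs_key x z y hyx (hyx.trans hxz)])

/-- **Lemma A, sorted case.** If `z ≤ y ≤ x` and `0 ≤ x + y + z` then either `m = x + y` or `m = x − z`
satisfies `0 ≤ m` and `x² + y² + z² ≤ m²`. -/
theorem hex_sorted (x y z : ℝ) (hxy : y ≤ x) (hyz : z ≤ y) (h : 0 ≤ x + y + z) :
    (0 ≤ x + y ∧ x ^ 2 + y ^ 2 + z ^ 2 ≤ (x + y) ^ 2) ∨
    (0 ≤ x - z ∧ x ^ 2 + y ^ 2 + z ^ 2 ≤ (x - z) ^ 2) := by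
  rcases le_or_gt 0 z with hz | hz
  · -- `0 ≤ z ≤ y ≤ x`: `z² ≤ yz ≤ xy`
    left
    refine ⟨by linarith, ?_⟩
    nlinarith [mul_le_mul_of_nonneg_right hyz hz, mul_le_mul_of_nonneg_right hxy (hz.trans hyz),
      mul_nonneg (hz.trans (hyz.trans hxy)) (hz.trans hyz)]
  · rcases le_or_gt (-z) y with hzy | hzy
    · -- `0 < -z ≤ y ≤ x`: `z² ≤ y(-z) ≤ y² ≤ xy`
      left
      have hy : 0 ≤ y := by linarith
      refine ⟨by linarith, ?_⟩
      nlinarith [mul_le_mul_of_nonneg_right hzy (neg_nonneg.2 hz.le), mul_le_mul_of_nonneg_left hzy hy,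
        mul_le_mul_of_nonneg_right hxy hy]
    · -- `y < -z`: use `x - z`, `y² ≤ x(-z)`
      right
      refine ⟨by linarith, ?_⟩
      rcases le_or_gt 0 y with hy | hy
      · -- `0 ≤ y < -z`, `y ≤ x`: `y² ≤ xy ≤ x(-z)`
        nlinarith [mul_le_mul_of_nonneg_right hxy hy, mul_le_mul_of_nonneg_left hzy.le (hy.trans hxy)]
      · -- `z ≤ y < 0 ≤ x`, `x ≥ -y`: `y² = (-y)(-y) ≤ x(-y) ≤ x(-z)`
        have hx : -y ≤ x := by linarith
        have hx0 : 0 ≤ x := by linarith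
        nlinarith [mul_le_mul_of_nonneg_right hx (neg_nonneg.2 hy.le),
          mul_le_mul_of_nonneg_left (neg_le_neg hyz) hx0]

/-- Packaging a leaf of `hex_key`. -/
theorem hex_leaf {x y z : ℝ} (a b c : ℤ) (h3 : ![3 * a, 3 * b, 3 * c] ∈ hcpInt)
    (hR : ![3 * a - 2 * (a + b + c), 3 * b - 2 * (a + b + c), 3 * c - 2 * (a + b + c)] ∈ hcpInt)
    {m : ℝ} (hm : (a : ℝ) * x + b * y + c * z = m) (h0 : 0 ≤ m)
    (h1 : x ^ 2 + y ^ 2 + z ^ 2 ≤ m ^ 2) :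
    ∃ a b c : ℤ, ![3 * a, 3 * b, 3 * c] ∈ hcpInt ∧
      ![3 * a - 2 * (a + b + c), 3 * b - 2 * (a + b + c), 3 * c - 2 * (a + b + c)] ∈ hcpInt ∧
      0 ≤ (a : ℝ) * x + b * y + c * z ∧ x ^ 2 + y ^ 2 + z ^ 2 ≤ ((a : ℝ) * x + b * y + c * z) ^ 2 :=
  ⟨a, b, c, h3, hR, by rw [hm]; exact h0, by rw [hm]; exact h1⟩

/-- **Lemma A (upper half-space).** If `0 ≤ x + y + z` then some `w = (a, b, c)` among
`(1,1,0), (1,0,1), (0,1,1), ±(1,−1,0), ±(1,0,−1), ±(0,1,−1)` — recorded as: `3w ∈ hcpInt` (upper triangle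
and hexagon) and its mirror image `3w − 2(a+b+c)(1,1,1) ∈ hcpInt` (lower triangle and hexagon) — has
`0 ≤ ⟪(x,y,z), w⟫` and `x² + y² + z² ≤ ⟪(x,y,z), w⟫²`.  By the `S₃`-symmetry this is `hex_sorted`. -/
theorem hex_key (x y z : ℝ) (h : 0 ≤ x + y + z) :
    ∃ a b c : ℤ, ![3 * a, 3 * b, 3 * c] ∈ hcpInt ∧
      ![3 * a - 2 * (a + b + c), 3 * b - 2 * (a + b + c), 3 * c - 2 * (a + b + c)] ∈ hcpInt ∧
      0 ≤ (a : ℝ) * x + b * y + c * z ∧ x ^ 2 + y ^ 2 + z ^ 2 ≤ ((a : ℝ) * x + b * y + c * z) ^ 2 := by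
  rcases le_total y x with hxy | hyx
  · rcases le_total z y with hyz | hzy
    · -- `z ≤ y ≤ x`
      rcases hex_sorted x y z hxy hyz h with ⟨h0, h1⟩ | ⟨h0, h1⟩
      · exact hex_leaf 1 1 0 (by decide) (by decide) (by push_cast; ring) h0 h1
      · exact hex_leaf 1 0 (-1) (by decide) (by decide) (by push_cast; ring) h0 h1
    · rcases le_total z x with hxz | hzx
      · -- `y ≤ z ≤ x`
        rcases hex_sorted x z y hxz hzy (by linarith) with ⟨h0, h1⟩ | ⟨h0, h1⟩
        · exact hex_leaf 1 0 1 (by decide) (by decide) (by push_cast; ring) h0 (by linarith [h1])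
        · exact hex_leaf 1 (-1) 0 (by decide) (by decide) (by push_cast; ring) h0 (by linarith [h1])
      · -- `y ≤ x ≤ z`
        rcases hex_sorted z x y hzx hxy (by linarith) with ⟨h0, h1⟩ | ⟨h0, h1⟩
        · exact hex_leaf 1 0 1 (by decide) (by decide) (m := x + z) (by push_cast; ring)
            (by linarith [h0]) (by linarith [h1])
        · exact hex_leaf 0 (-1) 1 (by decide) (by decide) (m := z - y) (by push_cast; ring)
            (by linarith [h0]) (by linarith [h1])
  · rcases le_total z x with hxz | hzx
    · -- `z ≤ x ≤ y`
      rcases hex_sorted y x z hyx hxz (by linarith) with ⟨h0, h1⟩ | ⟨h0, h1⟩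
      · exact hex_leaf 1 1 0 (by decide) (by decide) (m := x + y) (by push_cast; ring)
          (by linarith [h0]) (by linarith [h1])
      · exact hex_leaf 0 1 (-1) (by decide) (by decide) (m := y - z) (by push_cast; ring)
          (by linarith [h0]) (by linarith [h1])
    · rcases le_total z y with hyz | hzy
      · -- `x ≤ z ≤ y`
        rcases hex_sorted y z x hyz hzx (by linarith) with ⟨h0, h1⟩ | ⟨h0, h1⟩
        · exact hex_leaf 0 1 1 (by decide) (by decide) (m := y + z) (by push_cast; ring)
            (by linarith [h0]) (by linarith [h1])
        · exact hex_leaf (-1) 1 0 (by decide) (by decide) (m := y - x) (by push_cast; ring)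
            (by linarith [h0]) (by linarith [h1])
      · -- `x ≤ y ≤ z`
        rcases hex_sorted z y x hzy hyx (by linarith) with ⟨h0, h1⟩ | ⟨h0, h1⟩
        · exact hex_leaf 0 1 1 (by decide) (by decide) (m := y + z) (by push_cast; ring)
            (by linarith [h0]) (by linarith [h1])
        · exact hex_leaf (-1) 0 1 (by decide) (by decide) (m := z - x) (by push_cast; ring)
            (by linarith [h0]) (by linarith [h1])

/-! ### From an integer witness to a pattern point -/

/-- The inner product of `v` with the scaled integer vector `(a, b, c)/√N`. -/
theorem inner_smul_intVec (v : EuclideanSpace ℝ (Fin 3)) (N : ℕ) (a b c : ℤ) :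
    inner ℝ v ((Real.sqrt N)⁻¹ • intVec ![a, b, c]) =
      (Real.sqrt N)⁻¹ * ((a : ℝ) * v 0 + b * v 1 + c * v 2) := by
  rw [real_inner_smul_right]
  congr 1
  simp only [PiLp.inner_apply, RCLike.inner_apply, conj_trivial, Fin.sum_univ_three, intVec_apply,
    Matrix.cons_val_zero, Matrix.cons_val_one, Matrix.cons_val]

/-- **From a witness to a pattern point.** If `(a, b, c) ∈ S`, `m = a·v₀ + b·v₁ + c·v₂ ≥ 0` and
`N·‖v‖² ≤ 2m²` (`N > 0`), then `p = (a, b, c)/√N ∈ scaledPattern S N` has `‖v‖² ≤ 2⟪v, p⟫²` and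
`0 ≤ ⟪v, p⟫`. -/
theorem cover_of_witness {S : Finset (Fin 3 → ℤ)} {N : ℕ} (hN : 0 < N) (v : EuclideanSpace ℝ (Fin 3))
    {a b c : ℤ} (hw : ![a, b, c] ∈ S) (m : ℝ) (hm : (a : ℝ) * v 0 + b * v 1 + c * v 2 = m) (h0 : 0 ≤ m)
    (hsq : (N : ℝ) * (v 0 ^ 2 + v 1 ^ 2 + v 2 ^ 2) ≤ 2 * m ^ 2) :
    ∃ p ∈ scaledPattern S N, ‖v‖ ^ 2 ≤ 2 * (inner ℝ v p) ^ 2 ∧ 0 ≤ inner ℝ v p := by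
  have hNpos : (0 : ℝ) < N := by exact_mod_cast hN
  have hnorm : ‖v‖ ^ 2 = v 0 ^ 2 + v 1 ^ 2 + v 2 ^ 2 := by
    rw [EuclideanSpace.real_norm_sq_eq, Fin.sum_univ_three]
  refine ⟨(Real.sqrt N)⁻¹ • intVec ![a, b, c],
    Finset.mem_image_of_mem (fun w => (Real.sqrt N)⁻¹ • intVec w) hw, ?_, ?_⟩
  · rw [inner_smul_intVec, hm, hnorm, mul_pow, inv_pow, Real.sq_sqrt hNpos.le]
    have key : v 0 ^ 2 + v 1 ^ 2 + v 2 ^ 2 ≤ 2 * m ^ 2 / N := by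
      rw [le_div_iff₀ hNpos]; linarith [hsq]
    calc v 0 ^ 2 + v 1 ^ 2 + v 2 ^ 2 ≤ 2 * m ^ 2 / N := key
      _ = 2 * ((N : ℝ)⁻¹ * m ^ 2) := by ring
  · rw [inner_smul_intVec, hm]
    exact mul_nonneg (inv_nonneg.2 (Real.sqrt_nonneg _)) h0

/-! ### The two coverings for `A = id` -/

/-- **FCC covering (identity isometry).** Every `v ∈ ℝ³` has a point `p` of the FCC kissing pattern with
`‖v‖² ≤ 2⟪v, p⟫²` and `0 ≤ ⟪v, p⟫`. -/
theorem fcc_cover (v : EuclideanSpace ℝ (Fin 3)) :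
    ∃ p ∈ fccKissingPattern, ‖v‖ ^ 2 ≤ 2 * (inner ℝ v p) ^ 2 ∧ 0 ≤ inner ℝ v p := by
  obtain ⟨a, b, c, hmem, h0, h1⟩ := fcc_key (v 0) (v 1) (v 2)
  exact cover_of_witness (S := fccInt) (N := 2) (by norm_num) v hmem _ rfl h0
    (by push_cast; linarith [h1])

/-- **HCP covering (identity isometry).** Every `v ∈ ℝ³` has a point `p` of the HCP kissing pattern with
`‖v‖² ≤ 2⟪v, p⟫²` and `0 ≤ ⟪v, p⟫`: Lemma A in the upper half-space `v₀ + v₁ + v₂ ≥ 0`, and Lemma A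
applied to the mirror image of `v` in the hexagonal plane otherwise. -/
theorem hcp_cover (v : EuclideanSpace ℝ (Fin 3)) :
    ∃ p ∈ hcpKissingPattern, ‖v‖ ^ 2 ≤ 2 * (inner ℝ v p) ^ 2 ∧ 0 ≤ inner ℝ v p := by
  rcases le_total 0 (v 0 + v 1 + v 2) with hs | hs
  · obtain ⟨a, b, c, h3, -, h0, h1⟩ := hex_key (v 0) (v 1) (v 2) hs
    exact cover_of_witness (S := hcpInt) (N := 18) (by norm_num) v h3
      (3 * ((a : ℝ) * v 0 + b * v 1 + c * v 2)) (by push_cast; ring)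
      (mul_nonneg (by norm_num) h0) (by push_cast; nlinarith [h1])
  · obtain ⟨s, hs_def⟩ : ∃ s : ℝ, s = v 0 + v 1 + v 2 := ⟨_, rfl⟩
    rw [← hs_def] at hs
    obtain ⟨a, b, c, -, hR, h0, h1⟩ :=
      hex_key (v 0 - 2 / 3 * s) (v 1 - 2 / 3 * s) (v 2 - 2 / 3 * s) (by linarith)
    have e : (v 0 - 2 / 3 * s) ^ 2 + (v 1 - 2 / 3 * s) ^ 2 + (v 2 - 2 / 3 * s) ^ 2 =
        v 0 ^ 2 + v 1 ^ 2 + v 2 ^ 2 := by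
      rw [hs_def]; ring
    refine cover_of_witness (S := hcpInt) (N := 18) (by norm_num) v hR
      (3 * ((a : ℝ) * (v 0 - 2 / 3 * s) + b * (v 1 - 2 / 3 * s) + c * (v 2 - 2 / 3 * s))) ?_
      (mul_nonneg (by norm_num) h0) ?_
    · rw [hs_def]; push_cast; ring
    · push_cast; nlinarith [h1, e]

/-! ### The stub -/

/-- **Stub 5 — covering radius `45°` of the kissing patterns**: for every linear isometry `A` of `ℝ³` and
every vector `u`, some point `p` of the FCC pattern and some point of the HCP pattern (twelve unit vectors
each) satisfy `‖u‖² ≤ 2⟪u, A p⟫²` with `⟪u, A p⟫ ≥ 0` (i.e. the angle between `u` and `A p` is at most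
`45°`).  Reduction to `A = id`: `A` is onto (`LinearIsometry.toLinearIsometryEquiv`), `u = A v`,
`‖A v‖ = ‖v‖` and `⟪A v, A p⟫ = ⟪v, p⟫`; then `fcc_cover` and `hcp_cover`. -/
theorem stub_patternCovering :
    ∀ (A : EuclideanSpace ℝ (Fin 3) →ₗᵢ[ℝ] EuclideanSpace ℝ (Fin 3)) (u : EuclideanSpace ℝ (Fin 3)),
      (∃ p ∈ fccKissingPattern, ‖u‖ ^ 2 ≤ 2 * (inner ℝ u (A p)) ^ 2 ∧ 0 ≤ inner ℝ u (A p)) ∧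
      (∃ p ∈ hcpKissingPattern, ‖u‖ ^ 2 ≤ 2 * (inner ℝ u (A p)) ^ 2 ∧ 0 ≤ inner ℝ u (A p)) := by
  intro A u
  obtain ⟨v, hv⟩ := (A.toLinearIsometryEquiv rfl).surjective u
  rw [LinearIsometry.coe_toLinearIsometryEquiv] at hv
  subst hv
  simp only [LinearIsometry.inner_map_map, LinearIsometry.norm_map]
  exact ⟨fcc_cover v, hcp_cover v⟩

end Summit.AtomisticToContinuum.Crystallization.Theorems.PalmUnimodularRigidityMinimiserShells.PatternCovering
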